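import Mathlib
import HarnessLib
import Summits.Ventures.LatticeQCDFlow.Scoring.RegenerativeEstimatorSigma
import Summits.Ventures.LatticeQCDFlow.Scoring.RegenerativeVarianceEstimatorPlugIn

/-!
# A certified regenerative error bar FROM THE RUN'S OWN DATA: "the tour estimate misses `π(f)` by
# `≥ s` although the plug-in tour variance certifies `s` at level `η₀`" has probability
# `≤ η₀ + ((2C)⁴24/(ε⁴a²) + 24 + 4((2−ε)(2C)²/s'² + 1 − ε))/R`

HONEST FRAMING: exact (Metropolis-corrected) sampling algorithms for lattice gauge theory;
figures of merit are autocorrelation/cost numbers at stated couplings and volumes; no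
continuum-physics claim.

Venture `LatticeQCDFlow` (cell pub-lqcd), topic `Scoring`; FANOUT row 8 (`s0-cpn-nemc`, GEN-17).
NEW WORK of the cell, not a published result; no definition is introduced.  The regenerative
counterpart of `Scoring/EmpiricalErrorBar.lean` (GEN-14, plug-in variance of a time average).
`Scoring/RegenerativeEstimatorSigma.lean` certifies the tour estimator at the CLT scale,
`P(s ≤ |Â_R − π f|) ≤ 4(ε² v/s² + 1 − ε)/R` with `v = E_ν̂[Z_0²]` (`ε v = σ²_f`) — but `v` is unknown;
`Scoring/RegenerativeVarianceEstimatorPlugIn.lean` says the COMPUTABLE statistic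
`V̂_R = (1/R) Σ (Y_i − Â_R N_i)²` is within `r = a + 3(4Cs' + s'²)/ε²` of `v` except with probability
`δ_R = ((2C)⁴24/(ε⁴a²) + 24 + 4((2−ε)(2C)²/s'² + 1 − ε))/R`.  A two-case argument (either the
true-`v` certificate already holds at level `η₀`, or the data certificate forces `|V̂_R − v| ≥ r`)
gives the DATA-DRIVEN statement: for every `η₀ ≥ 0`,
`P( s ≤ |Â_R − π f|  ∧  4(ε²(V̂_R + r)/s² + 1 − ε)/R ≤ η₀ ) ≤ η₀ + δ_R` — whenever the printed
quantity computed from the tours is below `η₀`, the precision claim `|Â_R − π f| < s` fails with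
probability at most `η₀ + δ_R`; from any start, for any minorising law, CLT-free, variance-driven
in its leading term.  Printed counterpart NAMED ONLY: the regenerative standard error
`√(Σ(Y_i − Â N_i)²)/Σ N_i` of Mykland–Tierney–Yu 1995 §3 (used there with a CLT); nothing is cited as
a fact.

## Content (`e = ε.toReal`; `0 < ε < 1`; `π` invariant; `|f| ≤ C`; any start; `R ≥ 1`; `s, a, s' > 0`;
## `0 ≤ η₀`; `r = a + 3(4Cs' + s'²)/e²`)

* **`regenerative_empirical_errorBar`** — THE CERTIFICATE displayed above.

NOT CLAIMED: optimal constants; a confidence INTERVAL in the frequentist-exact sense (this is a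
one-sided certificate); any `ε` of a concrete sampler.
-/

noncomputable section

namespace Summit.Ventures.LatticeQCDFlow.Scoring

open MeasureTheory ProbabilityTheory Filter Finset Preorder Literature.Probability.MarkovChains
open scoped ENNReal

section Empirical

variable {Ω : Type*} [MeasurableSpace Ω]
  {κ : Kernel Ω Ω} [IsMarkovKernel κ] {ν : Measure Ω} [IsProbabilityMeasure ν] {ε : ℝ≥0∞}
  {hmin : ∀ x {B : Set Ω}, MeasurableSet B → ε * ν B ≤ κ x B}
  (κs : Kernel (Ω × Bool) (Ω × Bool)) [IsMarkovKernel κs]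
  (μs : Measure (Ω × Bool)) [IsProbabilityMeasure μs]

/-- **THE DATA-DRIVEN REGENERATIVE ERROR BAR.**  See the module docstring: with
`Â_R = Σ Y_i / Σ N_i`, `V̂_R = (1/R) Σ (Y_i − Â_R N_i)²`, `r = a + 3(4Cs' + s'²)/e²`:
`P(s ≤ |Â_R − π f| ∧ 4(e²(V̂_R + r)/s² + (1 − e))/R ≤ η₀) ≤ η₀ + ((2C)⁴24/(e⁴a²) + 24 + 4((2−e)(2C)²/s'² + (1−e)))/R`. -/
theorem regenerative_empirical_errorBar {π : Measure Ω} [IsProbabilityMeasure π]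
    (hπ : Kernel.Invariant κ π) (hε0 : 0 < ε) (hε : ε < 1)
    (hκs : ∀ p, κs p = (ε • ν).map (fun y : Ω => (y, true))
      + ((1 - ε) • Doeblin.residualKernel κ ν ε hmin p.1).map (fun y : Ω => (y, false)))
    {f : Ω → ℝ} (hf : Measurable f) {C : ℝ} (hC : ∀ x, |f x| ≤ C) {R : ℕ} (hR : 0 < R)
    {s : ℝ} (hs : 0 < s) {a : ℝ} (ha : 0 < a) {s' : ℝ} (hs' : 0 < s') {η₀ : ℝ} (hη : 0 ≤ η₀) :
    (Kernel.trajMeasure (X := fun _ : ℕ => Ω × Bool) μs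
        (fun n : ℕ => κs.comap (fun h : (i : ↥(Finset.Iic n)) → Ω × Bool =>
          h ⟨n, Finset.mem_Iic.2 le_rfl⟩) (measurable_pi_apply _))).real
      ({x | s ≤ |(∑ i ∈ Finset.range R, ∑' u, (if (∑ s ∈ Finset.range u,
            (if (x (s + 1)).2 then (1 : ℕ) else 0)) = i + 1 then (1 : ℝ) else 0) * f (x u).1)
          / (∑ i ∈ Finset.range R, ∑' u, (if (∑ s ∈ Finset.range u,
            (if (x (s + 1)).2 then (1 : ℕ) else 0)) = i + 1 then (1 : ℝ) else 0))
          - ∫ z, f z ∂π|}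
      ∩ {x | 4 * (ε.toReal ^ 2 * ((∑ i ∈ Finset.range R, ((∑' u, (if (∑ s ∈ Finset.range u,
              (if (x (s + 1)).2 then (1 : ℕ) else 0)) = i + 1 then (1 : ℝ) else 0) * f (x u).1)
            - ((∑ i ∈ Finset.range R, ∑' u, (if (∑ s ∈ Finset.range u,
                (if (x (s + 1)).2 then (1 : ℕ) else 0)) = i + 1 then (1 : ℝ) else 0) * f (x u).1)
              / (∑ i ∈ Finset.range R, ∑' u, (if (∑ s ∈ Finset.range u,
                (if (x (s + 1)).2 then (1 : ℕ) else 0)) = i + 1 then (1 : ℝ) else 0)))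
            * (∑' u, (if (∑ s ∈ Finset.range u, (if (x (s + 1)).2 then (1 : ℕ) else 0)) = i + 1
              then (1 : ℝ) else 0))) ^ 2) / R + (a + 3 * (4 * C * s' + s' ^ 2) / ε.toReal ^ 2)) / s ^ 2
          + (1 - ε.toReal)) / R ≤ η₀})
      ≤ η₀ + ((2 * C) ^ 4 * 24 / (ε.toReal ^ 4 * a ^ 2) + 24
          + 4 * ((2 - ε.toReal) * (2 * C) ^ 2 / s' ^ 2 + (1 - ε.toReal))) / R := by
  haveI hνt : IsProbabilityMeasure (ν.map (fun y : Ω => (y, true))) :=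
    Measure.isProbabilityMeasure_map (measurable_tagCoin true).aemeasurable
  set P := Kernel.trajMeasure (X := fun _ : ℕ => Ω × Bool) μs
      (fun n : ℕ => κs.comap (fun h : (i : ↥(Finset.Iic n)) → Ω × Bool =>
        h ⟨n, Finset.mem_Iic.2 le_rfl⟩) (measurable_pi_apply _)) with hP
  set c := ∫ z, f z ∂π with hc
  set v := ∫ y, (∑' u, (if (∑ s ∈ Finset.range u, (if (y (s + 1)).2 then (1 : ℕ) else 0)) = 0
      then (1 : ℝ) else 0) * (f (y u).1 - c)) ^ 2
      ∂(Kernel.trajMeasure (X := fun _ : ℕ => Ω × Bool) (ν.map (fun y : Ω => (y, true)))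
        (fun n : ℕ => κs.comap (fun h : (i : ↥(Finset.Iic n)) → Ω × Bool =>
          h ⟨n, Finset.mem_Iic.2 le_rfl⟩) (measurable_pi_apply _))) with hv
  set r : ℝ := a + 3 * (4 * C * s' + s' ^ 2) / ε.toReal ^ 2 with hr
  set δ : ℝ := ((2 * C) ^ 4 * 24 / (ε.toReal ^ 4 * a ^ 2) + 24
      + 4 * ((2 - ε.toReal) * (2 * C) ^ 2 / s' ^ 2 + (1 - ε.toReal))) / R with hδ
  have he0 : 0 < ε.toReal := ENNReal.toReal_pos hε0.ne' (ne_top_of_lt hε)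
  have he1 : ε.toReal ≤ 1 := by
    have := (ENNReal.toReal_lt_toReal (ne_top_of_lt hε) ENNReal.one_ne_top).2 hε
    rw [ENNReal.toReal_one] at this; exact this.le
  have hR0 : (0 : ℝ) < R := Nat.cast_pos.2 hR
  have hC0 : 0 ≤ C := (abs_nonneg _).trans (hC (Classical.choice (nonempty_of_isProbabilityMeasure π)))
  have hδ0 : 0 ≤ δ := by
    have h1 : 0 ≤ 2 - ε.toReal := by linarith
    have h2 : 0 ≤ 1 - ε.toReal := by linarith
    positivity
  -- the two certificates
  have hsig := regenerative_estimator_confidence_sigma κs μs (κ := κ) (ν := ν) (hmin := hmin) hπ hε0 hε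
    hκs hf hC hR hs
  rw [← splitChain_fresh_sq_centredTourSum_eq_greenKubo κs (κ := κ) (ν := ν) (hmin := hmin) hπ hε0 hε
    hκs hf hC, ← hP, ← hc, ← hv] at hsig
  have hplug := regenerative_variance_plugIn_confidence κs μs (κ := κ) (ν := ν) (hmin := hmin) hπ hε0
    hε hκs hf hC hR ha hs'
  rw [← hP, ← hc, ← hv, ← hr, ← hδ] at hplug
  -- case split on the (deterministic) true-variance certificate
  by_cases hcase : 4 * (ε.toReal * (ε.toReal * v) / s ^ 2 + (1 - ε.toReal)) / R ≤ η₀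
  · calc P.real _ ≤ P.real {x | s ≤ |(∑ i ∈ Finset.range R, ∑' u, (if (∑ s ∈ Finset.range u,
            (if (x (s + 1)).2 then (1 : ℕ) else 0)) = i + 1 then (1 : ℝ) else 0) * f (x u).1)
          / (∑ i ∈ Finset.range R, ∑' u, (if (∑ s ∈ Finset.range u,
            (if (x (s + 1)).2 then (1 : ℕ) else 0)) = i + 1 then (1 : ℝ) else 0)) - c|} :=
          measureReal_mono Set.inter_subset_left
      _ ≤ 4 * (ε.toReal * (ε.toReal * v) / s ^ 2 + (1 - ε.toReal)) / R := hsig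
      _ ≤ η₀ + δ := hcase.trans (le_add_of_nonneg_right hδ0)
  · -- the data certificate forces `r ≤ |V̂_R − v|`
    have hincl : ({x : ℕ → Ω × Bool | s ≤ |(∑ i ∈ Finset.range R, ∑' u, (if (∑ s ∈ Finset.range u,
            (if (x (s + 1)).2 then (1 : ℕ) else 0)) = i + 1 then (1 : ℝ) else 0) * f (x u).1)
          / (∑ i ∈ Finset.range R, ∑' u, (if (∑ s ∈ Finset.range u,
            (if (x (s + 1)).2 then (1 : ℕ) else 0)) = i + 1 then (1 : ℝ) else 0)) - c|}
        ∩ {x | 4 * (ε.toReal ^ 2 * ((∑ i ∈ Finset.range R, ((∑' u, (if (∑ s ∈ Finset.range u,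
              (if (x (s + 1)).2 then (1 : ℕ) else 0)) = i + 1 then (1 : ℝ) else 0) * f (x u).1)
            - ((∑ i ∈ Finset.range R, ∑' u, (if (∑ s ∈ Finset.range u,
                (if (x (s + 1)).2 then (1 : ℕ) else 0)) = i + 1 then (1 : ℝ) else 0) * f (x u).1)
              / (∑ i ∈ Finset.range R, ∑' u, (if (∑ s ∈ Finset.range u,
                (if (x (s + 1)).2 then (1 : ℕ) else 0)) = i + 1 then (1 : ℝ) else 0)))
            * (∑' u, (if (∑ s ∈ Finset.range u, (if (x (s + 1)).2 then (1 : ℕ) else 0)) = i + 1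
              then (1 : ℝ) else 0))) ^ 2) / R + r) / s ^ 2 + (1 - ε.toReal)) / R ≤ η₀})
        ⊆ {x | r ≤ |(∑ i ∈ Finset.range R, ((∑' u, (if (∑ s ∈ Finset.range u,
              (if (x (s + 1)).2 then (1 : ℕ) else 0)) = i + 1 then (1 : ℝ) else 0) * f (x u).1)
            - ((∑ i ∈ Finset.range R, ∑' u, (if (∑ s ∈ Finset.range u,
                (if (x (s + 1)).2 then (1 : ℕ) else 0)) = i + 1 then (1 : ℝ) else 0) * f (x u).1)
              / (∑ i ∈ Finset.range R, ∑' u, (if (∑ s ∈ Finset.range u,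
                (if (x (s + 1)).2 then (1 : ℕ) else 0)) = i + 1 then (1 : ℝ) else 0)))
            * (∑' u, (if (∑ s ∈ Finset.range u, (if (x (s + 1)).2 then (1 : ℕ) else 0)) = i + 1
              then (1 : ℝ) else 0))) ^ 2) / R - v|} := by
      intro x hx
      obtain ⟨-, hcert⟩ := hx
      simp only [Set.mem_setOf_eq] at hcert ⊢
      set V := (∑ i ∈ Finset.range R, ((∑' u, (if (∑ s ∈ Finset.range u,
              (if (x (s + 1)).2 then (1 : ℕ) else 0)) = i + 1 then (1 : ℝ) else 0) * f (x u).1)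
            - ((∑ i ∈ Finset.range R, ∑' u, (if (∑ s ∈ Finset.range u,
                (if (x (s + 1)).2 then (1 : ℕ) else 0)) = i + 1 then (1 : ℝ) else 0) * f (x u).1)
              / (∑ i ∈ Finset.range R, ∑' u, (if (∑ s ∈ Finset.range u,
                (if (x (s + 1)).2 then (1 : ℕ) else 0)) = i + 1 then (1 : ℝ) else 0)))
            * (∑' u, (if (∑ s ∈ Finset.range u, (if (x (s + 1)).2 then (1 : ℕ) else 0)) = i + 1
              then (1 : ℝ) else 0))) ^ 2) / R with hV
      by_contra hlt
      push Not at hlt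
      have hvV : v < V + r := by
        have := neg_lt_of_abs_lt hlt
        linarith
      apply hcase
      have hmono : 4 * (ε.toReal * (ε.toReal * v) / s ^ 2 + (1 - ε.toReal)) / R
          ≤ 4 * (ε.toReal ^ 2 * (V + r) / s ^ 2 + (1 - ε.toReal)) / R := by
        have h1 : ε.toReal * (ε.toReal * v) ≤ ε.toReal ^ 2 * (V + r) := by
          rw [← mul_assoc, ← sq]; exact mul_le_mul_of_nonneg_left hvV.le (sq_nonneg _)
        have h2 : ε.toReal * (ε.toReal * v) / s ^ 2 ≤ ε.toReal ^ 2 * (V + r) / s ^ 2 :=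
          div_le_div_of_nonneg_right h1 (by positivity)
        have h3 : 4 * (ε.toReal * (ε.toReal * v) / s ^ 2 + (1 - ε.toReal))
            ≤ 4 * (ε.toReal ^ 2 * (V + r) / s ^ 2 + (1 - ε.toReal)) := by linarith
        exact div_le_div_of_nonneg_right h3 hR0.le
      exact hmono.trans hcert
    calc P.real _ ≤ P.real _ := measureReal_mono hincl
      _ ≤ δ := hplug
      _ ≤ η₀ + δ := le_add_of_nonneg_left hη

end Empirical

end Summit.Ventures.LatticeQCDFlow.Scoring

end
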